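import Literature.Computability.AlgebraicComplexity.NewtonPolygonTauTransfer
import Literature.Computability.AlgebraicComplexity.BirkhoffShadow
import Literature.Computability.AlgebraicComplexity.DetInVP
import HarnessLib

/-!
# The Birkhoff-shadow ceiling forced by the weak Newton-polygon τ-conjecture

Hrubeš–Yehudayoff (*Shadows of Newton polytopes*, CCC 2021, p. 9:2, footnote 1, crediting an
observation of M. Forbes) remark without proof that the τ-conjecture for Newton polygons implies
`σ(DS_n) ≤ 2^{O(√n log² n)}`, where `σ(DS_n)` is the shadow complexity of the Birkhoff polytope
(`birkhoffShadowVertexCount`), so that `σ(DS_n) = 2^{Ω(n)}` — their Open Problem 1 — would refute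
it.  This file proves the kernel-checked form of that remark for the WEAK conjecture
`KPTT.newtonTauWeak` (the in-tree sufficient condition for `VP ≠ VNP`, via `KPTT.theorem1_holds`):

* `exists_sps_aeval_detPoly` — depth-four reduction (Tavenas, in-tree `SLP.exists_sum_prod`) for the
  determinant `DET_n` (`L(DET_n) ≤ 8(n+1)⁷`, in-tree `complexity_detPoly_le`) composed with an
  arbitrary substitution of the `n²` variables by bivariate terms: `DET_n(v) = ∑_{i<k} ∏_{j<m} g_ij`
  with `k, t ≤ (n+2)^{C(⌊√n⌋+1)}`, `m ≤ C(⌊√n⌋+1)`, every `g_ij` `t`-sparse, `C` absolute.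
* `newtonVertexCount_aeval_detPoly_le_of_newtonTauWeak` — hence, under `newtonTauWeak`, the Newton
  polygon of `DET_n(X^{a_ij} Y^{b_ij})` has at most `(n+2)^{c(⌊√n⌋+1)} = 2^{O(√n log n)}` vertices,
  for EVERY exponent pattern `a b : Fin n × Fin n → ℕ`, with one constant `c`.
* `separatingShadowCeiling_of_newtonTauWeak` — and therefore (`SeparatingShadowCeiling`) every
  shadow of `DS_n` under an integral map `x ↦ (⟨a,x⟩, ⟨b,x⟩)` separating the permutation matrices
  has at most that many vertices (the support of `DET_n(X^{a} Y^{b})` is then exactly the projected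
  vertex set, all coefficients being `±1`); its contrapositive is the refuter's kill switch.

Consequently any lower bound `σ(DS_n) ≥ 2^{ω(√n log n)}` along integral separating projections
refutes `newtonTauWeak` (the KILL SWITCH of the Newton-polygon line), while the conjecture predicts
the answer `2^{Θ̃(√n)}`-or-less to Hrubeš–Yehudayoff's Problem 1.  Solo programme artefact
(unit solo-ValiantsHypothesis-blind); no new named fact, everything below is proved.

References: Hrubeš–Yehudayoff 2021 (doi:10.4230/LIPIcs.CCC.2021.9) footnote 1, Prop. 23, Open
Problem 1; Koiran–Portier–Tavenas–Thomassé 2015 (arXiv:1308.2286) Thm. 1; Tavenas 2015 Thm. 1.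
-/

noncomputable section

open MvPolynomial


namespace Summit.ValiantsHypothesis.ValiantsHypothesis.Theorems

open Literature.Computability.AlgebraicComplexity
open Literature.Computability.AlgebraicComplexity.ArithCircuit

/-- **Depth four plus term substitution for the determinant.** There is an absolute constant `C`
such that for every `n` and every substitution `v` of the `n²` variables by bivariate terms,
`DET_n(v) = ∑_{i<k} ∏_{j<m} g_ij` with `k, t ≤ (n+2)^{C(⌊√n⌋+1)}`, `m ≤ C(⌊√n⌋+1)` and every
`g_ij` having at most `t` monomials.  (Tavenas' reduction at bottom degree `⌊√n⌋+1` applied to a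
minimal circuit for `DET_n`, `L(DET_n) ≤ 8(n+1)⁷`, degree `n`; a term substitution does not
increase the number of monomials.) -/
theorem exists_sps_aeval_detPoly :
    ∃ C : ℕ, ∀ (n : ℕ) (v : Fin n × Fin n → MvPolynomial (Fin 2) ℂ), (∀ x, IsMvTerm (v x)) →
      ∃ (k m t : ℕ) (g : Fin k → Fin m → MvPolynomial (Fin 2) ℂ),
        k ≤ (n + 2) ^ (C * (Nat.sqrt n + 1)) ∧
        m ≤ C * (Nat.sqrt n + 1) ∧
        t ≤ (n + 2) ^ (C * (Nat.sqrt n + 1)) ∧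
        (∀ i j, (g i j).support.card ≤ t) ∧
        (∑ i, ∏ j, g i j) = MvPolynomial.aeval v (detPoly (Fin n) ℂ) := by
  classical
  refine ⟨prop321Const 12, fun n v hv => ?_⟩
  have hB2 : 2 ≤ n + 2 := by omega
  set D : ℕ := Nat.sqrt n + 1 with hD
  have hD1 : 1 ≤ D := Nat.succ_pos _
  -- size of a minimal circuit for `DET_n`
  obtain ⟨s, hs⟩ : ∃ s : ℕ, complexity (detPoly (Fin n) ℂ) = s := ⟨_, rfl⟩
  have h8 : 8 ≤ (n + 2) ^ 3 := by
    calc 8 = 2 ^ 3 := by norm_num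
      _ ≤ (n + 2) ^ 3 := Nat.pow_le_pow_left hB2 3
  have hsle : s ≤ (n + 2) ^ 12 := by
    calc s = complexity (detPoly (Fin n) ℂ) := hs.symm
      _ ≤ 8 * (n + 1) ^ 7 := complexity_detPoly_le ℂ n
      _ ≤ (n + 2) ^ 3 * (n + 2) ^ 7 :=
          Nat.mul_le_mul h8 (Nat.pow_le_pow_left (by omega) 7)
      _ = (n + 2) ^ 10 := by rw [← pow_add]
      _ ≤ (n + 2) ^ 12 := Nat.pow_le_pow_right (by omega) (by omega)
  -- exponent bookkeeping with `E = 12`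
  have hsq : (n + 2) ^ 2 = n * n + 4 * n + 4 := by ring
  have h2E : (n + 2) ^ 2 ≤ (n + 2) ^ 12 := Nat.pow_le_pow_right (by omega) (by omega)
  have hsqrt_le : Nat.sqrt n ≤ n := Nat.sqrt_le_self n
  have hδ1 : n + 1 ≤ (n + 2) ^ 12 := by omega
  have hu1 : D + 1 ≤ (n + 2) ^ 12 := by omega
  have hδu : n * n + D ≤ (n + 2) ^ 12 := by omega
  have huD : D ≤ 2 * D := by omega
  have hRle : 8 * n / (D + 1) ≤ 16 * D := (rounds_le n).trans (by omega)
  -- the sparsity of a polynomial of degree `≤ D` in `n²` variables after a term substitution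
  have hsparse : ∀ p : MvPolynomial (Fin n × Fin n) ℂ, p.totalDegree ≤ D →
      (MvPolynomial.aeval v p).support.card ≤ (n + 2) ^ (prop321Const 12 * D) := by
    intro p hp
    calc (MvPolynomial.aeval v p).support.card ≤ p.support.card :=
          card_support_aeval_le_of_isMvTerm hv p
      _ ≤ (D + 1) * (Fintype.card (Fin n × Fin n) + D) ^ D :=
          DepthReduction.card_le_of_degree_le _ hD1 fun m hm => (le_totalDegree hm).trans hp
      _ = (D + 1) * (n * n + D) ^ D := by rw [Fintype.card_prod, Fintype.card_fin]
      _ ≤ (n + 2) ^ (prop321Const 12 * D) := prop321_tBound hB2 hD1 hu1 hδu huD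
  -- a minimal circuit for `DET_n` and its straight-line program
  obtain ⟨P, hP1, hP2, hP3⟩ := exists_computes_size_eq_complexity (detPoly (Fin n) ℂ)
  obtain ⟨S, hSlen, hcases⟩ := DepthReduction.exists_slp P hP1
  rw [show P.eval = detPoly (Fin n) ℂ from hP2] at hcases
  rw [hs] at hP3
  rcases hcases with ⟨i, hi, hval⟩ | htriv
  · -- main case: `DET_n` is a value of the straight-line program
    have hdegh : (S.val i).totalDegree ≤ n := by
      rw [← hval]
      simpa using (detPoly_isHomogeneous (n := Fin n) (k := ℂ)).totalDegree_le
    obtain ⟨L, hLsum, hLlen, hLT⟩ := S.exists_sum_prod n (t := D) hD1 hi hdegh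
    rw [hSlen, hP3] at hLlen
    refine ⟨L.length, 1 + 4 * (8 * n / (D + 1)), (n + 2) ^ (prop321Const 12 * D),
      fun i j => MvPolynomial.aeval v ((L[i.val]).getD j.val 1),
      hLlen.trans (prop321_kBound hB2 hD1 hδ1 hsle hRle), prop321_mBound hD1 hRle, le_rfl, ?_, ?_⟩
    · intro i j
      apply hsparse
      rcases DepthReduction.getD_one_mem_or (L[i.val]) j.val with hmem | hone
      · exact (hLT _ (List.getElem_mem _)).2 _ hmem
      · rw [hone, totalDegree_one]; exact Nat.zero_le _
    · rw [hval, ← hLsum]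
      have hprod : ∀ i : Fin L.length,
          ∏ j : Fin (1 + 4 * (8 * n / (D + 1))), MvPolynomial.aeval v ((L[i.val]).getD j.val 1) =
            MvPolynomial.aeval v (L[i.val]).prod := fun i => by
        rw [← map_prod, DepthReduction.prod_getD_one _ _ (hLT _ (List.getElem_mem _)).1]
      simp only [hprod]
      rw [map_list_sum, List.map_map]
      exact Fin.sum_univ_fun_getElem L (fun l => MvPolynomial.aeval v l.prod)
  · -- degenerate case: `DET_n` is a variable or a constant, a single term after substitution
    have hterm : IsMvTerm (MvPolynomial.aeval v (detPoly (Fin n) ℂ)) := by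
      rcases htriv with ⟨j, hj⟩ | ⟨c, hc⟩
      · rw [hj, MvPolynomial.aeval_X]; exact hv j
      · rw [hc, MvPolynomial.aeval_C, MvPolynomial.algebraMap_eq]; exact isMvTerm_C c
    have h1 : 1 ≤ (n + 2) ^ (prop321Const 12 * D) := Nat.one_le_pow _ _ (by omega)
    refine ⟨1, 1, 1, fun _ _ => MvPolynomial.aeval v (detPoly (Fin n) ℂ), h1,
      one_le_prop321Const_mul hD1, h1, fun _ _ => hterm.card_support_le, ?_⟩
    simp


/-- **The weak Newton-polygon τ-conjecture caps the Newton polygons of all bivariate projections of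
the determinant at `2^{O(√n log n)}` vertices.**  Under `KPTT.newtonTauWeak` there is a constant
`c` such that for every `n` and every substitution `v` of the `n²` variables by bivariate terms
(in particular `x_ij ↦ X^{a_ij} Y^{b_ij}`), `#vert Newt(DET_n(v)) ≤ (n+2)^{c(⌊√n⌋+1)}`.
(Hrubeš–Yehudayoff 2021, footnote 1, for the weak conjecture; `exists_sps_aeval_detPoly` and
arithmetic.) -/
theorem newtonVertexCount_aeval_detPoly_le_of_newtonTauWeak (hW : KPTT.newtonTauWeak) :
    ∃ c : ℕ, ∀ (n : ℕ) (v : Fin n × Fin n → MvPolynomial (Fin 2) ℂ), (∀ x, IsMvTerm (v x)) →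
      newtonVertexCount (MvPolynomial.aeval v (detPoly (Fin n) ℂ)) ≤
        (n + 2) ^ (c * (Nat.sqrt n + 1)) := by
  obtain ⟨C, hC⟩ := exists_sps_aeval_detPoly
  obtain ⟨a, b, hab⟩ := hW
  refine ⟨a * C + (2 * C + 2) * b, fun n v hv => ?_⟩
  obtain ⟨k, m, t, g, hk, hm, ht, hg, hsum⟩ := hC n v hv
  have hcount := hab k m t g hg
  rw [hsum] at hcount
  refine hcount.trans ?_
  set D := Nat.sqrt n + 1 with hD
  have hD1 : 1 ≤ D := Nat.succ_pos _
  have hB2 : 2 ≤ n + 2 := by omega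
  have hB1 : 1 ≤ n + 2 := by omega
  have h1 : 2 ^ (a * m) ≤ (n + 2) ^ (a * (C * D)) :=
    calc 2 ^ (a * m) ≤ (n + 2) ^ (a * m) := Nat.pow_le_pow_left hB2 _
      _ ≤ (n + 2) ^ (a * (C * D)) := Nat.pow_le_pow_right hB1 (Nat.mul_le_mul_left a hm)
  have hkt : k * t ≤ (n + 2) ^ (C * D + C * D) := by
    rw [pow_add]; exact Nat.mul_le_mul hk ht
  have hkt2 : k * t + 2 ≤ (n + 2) ^ (C * D + C * D + 2) := by
    have hp : 1 ≤ (n + 2) ^ (C * D + C * D) := Nat.one_le_pow _ _ hB1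
    have h4 : 4 ≤ (n + 2) ^ 2 := by
      calc 4 = 2 ^ 2 := by norm_num
        _ ≤ (n + 2) ^ 2 := Nat.pow_le_pow_left hB2 2
    rw [pow_add]
    calc k * t + 2 ≤ (n + 2) ^ (C * D + C * D) * 4 := by omega
      _ ≤ (n + 2) ^ (C * D + C * D) * (n + 2) ^ 2 := Nat.mul_le_mul_left _ h4
  have h2 : (k * t + 2) ^ b ≤ (n + 2) ^ ((C * D + C * D + 2) * b) := by
    rw [pow_mul]; exact Nat.pow_le_pow_left hkt2 b
  calc 2 ^ (a * m) * (k * t + 2) ^ b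
      ≤ (n + 2) ^ (a * (C * D)) * (n + 2) ^ ((C * D + C * D + 2) * b) := Nat.mul_le_mul h1 h2
    _ = (n + 2) ^ (a * (C * D) + (C * D + C * D + 2) * b) := by rw [← pow_add]
    _ ≤ (n + 2) ^ ((a * C + (2 * C + 2) * b) * D) := by
        refine Nat.pow_le_pow_right hB1 ?_
        have : a * (C * D) + (C * D + C * D + 2) * b + 2 * b * (D - 1) =
            (a * C + (2 * C + 2) * b) * D := by
          rcases Nat.exists_eq_add_of_le hD1 with ⟨D', hD'⟩
          rw [hD']; simp only [Nat.add_sub_cancel_left]; ring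
        omega

/-! ### From Newton polygons of `DET_n(X^a Y^b)` to shadows of the Birkhoff polytope -/

/-- The monomial substitution `x_ij ↦ X^{a_ij} Y^{b_ij}` (`X = X 0`, `Y = X 1`). -/
def monoSubst {n : ℕ} (a b : Fin n × Fin n → ℕ) (ij : Fin n × Fin n) : MvPolynomial (Fin 2) ℂ :=
  X 0 ^ a ij * X 1 ^ b ij

/-- The substituted monomial `X^{a ij} Y^{b ij}` is a term (monomial). [folklore] -/
theorem isMvTerm_monoSubst {n : ℕ} (a b : Fin n × Fin n → ℕ) (ij : Fin n × Fin n) :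
    IsMvTerm (monoSubst a b ij) :=
  (isMvTerm_X_pow _ _).mul (isMvTerm_X_pow _ _)

/-- The exponent of the monomial `∏_j X^{a(ρ j, j)} Y^{b(ρ j, j)}`. -/
def permExp {n : ℕ} (a b : Fin n × Fin n → ℕ) (ρ : Equiv.Perm (Fin n)) : Fin 2 →₀ ℕ :=
  ∑ j, (Finsupp.single 0 (a (ρ j, j)) + Finsupp.single 1 (b (ρ j, j)))

/-- The substitution value at `ij` as a single `monomial`. [folklore] -/
theorem monoSubst_eq_monomial {n : ℕ} (a b : Fin n × Fin n → ℕ) (ij : Fin n × Fin n) :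
    monoSubst a b ij = monomial (Finsupp.single 0 (a ij) + Finsupp.single 1 (b ij)) 1 := by
  rw [monoSubst, X_pow_eq_monomial, X_pow_eq_monomial, monomial_mul, mul_one]

/-- The product of the substituted monomials over a permutation is the monomial with exponent `permExp`. [folklore] -/
theorem prod_monoSubst {n : ℕ} (a b : Fin n × Fin n → ℕ) (ρ : Equiv.Perm (Fin n)) :
    ∏ j, monoSubst a b (ρ j, j) = monomial (permExp a b ρ) 1 := by
  rw [permExp, monomial_sum_index, C_1, one_mul]
  exact Finset.prod_congr rfl fun j _ => monoSubst_eq_monomial a b (ρ j, j)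

/-- First coordinate of `permExp a b ρ` is `Σ_j a(ρ j, j)`. [folklore] -/
theorem permExp_apply_zero {n : ℕ} (a b : Fin n × Fin n → ℕ) (ρ : Equiv.Perm (Fin n)) :
    permExp a b ρ 0 = ∑ j, a (ρ j, j) := by
  rw [permExp, Finsupp.finsetSum_apply]
  refine Finset.sum_congr rfl fun j _ => ?_
  simp

/-- Second coordinate of `permExp a b ρ` is `Σ_j b(ρ j, j)`. [folklore] -/
theorem permExp_apply_one {n : ℕ} (a b : Fin n × Fin n → ℕ) (ρ : Equiv.Perm (Fin n)) :
    permExp a b ρ 1 = ∑ j, b (ρ j, j) := by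
  rw [permExp, Finsupp.finsetSum_apply]
  refine Finset.sum_congr rfl fun j _ => ?_
  simp

/-- `DET_n(X^a Y^b) = ∑_ρ sign(ρ) · X^{permExp ρ}`. -/
theorem aeval_monoSubst_detPoly {n : ℕ} (a b : Fin n × Fin n → ℕ) :
    MvPolynomial.aeval (monoSubst a b) (detPoly (Fin n) ℂ) =
      ∑ ρ : Equiv.Perm (Fin n), monomial (permExp a b ρ) ((Equiv.Perm.sign ρ : ℤ) : ℂ) := by
  rw [detPoly, Matrix.det_apply, map_sum]
  refine Finset.sum_congr rfl fun ρ _ => ?_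
  rw [Units.smul_def, map_zsmul, map_prod]
  have : ∏ j, MvPolynomial.aeval (monoSubst a b) (Matrix.mvPolynomialX (Fin n) (Fin n) ℂ (ρ j) j) =
      monomial (permExp a b ρ) 1 := by
    rw [← prod_monoSubst]
    refine Finset.prod_congr rfl fun j _ => ?_
    rw [Matrix.mvPolynomialX_apply, MvPolynomial.aeval_X]
  rw [this, smul_monomial, zsmul_one]

/-- With a separating exponent pattern, the support of `DET_n(X^a Y^b)` is the set of the `n!`
exponents `permExp ρ` (all coefficients are `±1`). -/
theorem support_aeval_monoSubst_detPoly {n : ℕ} (a b : Fin n × Fin n → ℕ)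
    (hinj : Function.Injective (permExp a b)) :
    (MvPolynomial.aeval (monoSubst a b) (detPoly (Fin n) ℂ)).support =
      Finset.univ.image (permExp a b) := by
  classical
  rw [aeval_monoSubst_detPoly]
  have hne : ∀ ρ : Equiv.Perm (Fin n), (((Equiv.Perm.sign ρ : ℤ) : ℂ)) ≠ 0 := fun ρ => by
    rcases Int.units_eq_one_or (Equiv.Perm.sign ρ) with h | h <;> simp [h]
  ext e
  rw [mem_support_iff, coeff_sum, Finset.mem_image]
  simp only [coeff_monomial]
  constructor
  · intro h
    by_contra hne'
    apply h
    refine Finset.sum_eq_zero fun ρ _ => ?_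
    rw [if_neg]
    exact fun heq => hne' ⟨ρ, Finset.mem_univ _, heq⟩
  · rintro ⟨ρ, -, rfl⟩
    rw [Finset.sum_eq_single ρ]
    · rw [if_pos rfl]; exact hne ρ
    · intro ρ' _ hρ'
      rw [if_neg]
      exact fun heq => hρ' (hinj heq)
    · intro h; exact absurd (Finset.mem_univ ρ) h

/-- The integral projection `x ↦ (⟨a, x⟩, ⟨b, x⟩)` of `ℝ^{n×n}` onto `ℝ²`. -/
def intProj {n : ℕ} (a b : Fin n × Fin n → ℕ) : (Fin n × Fin n → ℝ) →ₗ[ℝ] (Fin 2 → ℝ) where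
  toFun x k := ∑ ij, (if k = 0 then (a ij : ℝ) else (b ij : ℝ)) * x ij
  map_add' x y := by
    ext k
    simp only [Pi.add_apply, mul_add, Finset.sum_add_distrib]
  map_smul' r x := by
    ext k
    simp only [Pi.smul_apply, smul_eq_mul, RingHom.id_apply, Finset.mul_sum]
    refine Finset.sum_congr rfl fun ij _ => ?_
    ring

/-- Evaluation of the integer projection `intProj a b`. [folklore] -/
theorem intProj_apply {n : ℕ} (a b : Fin n × Fin n → ℕ) (x : Fin n × Fin n → ℝ) (k : Fin 2) :
    intProj a b x k = ∑ ij, (if k = 0 then (a ij : ℝ) else (b ij : ℝ)) * x ij := rfl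

/-- The projection of the permutation matrix of `ρ` is the lattice point `permExp ρ`. -/
theorem intProj_permMatrix {n : ℕ} (a b : Fin n × Fin n → ℕ) (ρ : Equiv.Perm (Fin n)) :
    intProj a b (fun ij : Fin n × Fin n => if ρ ij.2 = ij.1 then (1 : ℝ) else 0) =
      fun i : Fin 2 => ((permExp a b ρ i : ℕ) : ℝ) := by
  ext k
  rw [intProj_apply]
  have key : ∀ c : Fin n × Fin n → ℝ,
      (∑ ij : Fin n × Fin n, c ij * (if ρ ij.2 = ij.1 then (1 : ℝ) else 0)) = ∑ j, c (ρ j, j) := by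
    intro c
    rw [Fintype.sum_prod_type, Finset.sum_comm]
    refine Finset.sum_congr rfl fun j _ => ?_
    simp only [mul_ite, mul_one, mul_zero]
    rw [Finset.sum_ite_eq]
    simp
  rw [key]
  fin_cases k
  · simp [permExp_apply_zero]
  · simp [permExp_apply_one]

/-- The projected permutation matrices are exactly the lattice points of the support of
`DET_n(X^a Y^b)` (for a separating pattern). -/
theorem image_intProj_permMatrixPoints {n : ℕ} (a b : Fin n × Fin n → ℕ)
    (hinj : Function.Injective (permExp a b)) :
    (intProj a b) '' permMatrixPoints n =
      (fun e : Fin 2 →₀ ℕ => fun i : Fin 2 => ((e i : ℕ) : ℝ)) ''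
        ((MvPolynomial.aeval (monoSubst a b) (detPoly (Fin n) ℂ)).support : Set (Fin 2 →₀ ℕ)) := by
  classical
  rw [support_aeval_monoSubst_detPoly a b hinj, Finset.coe_image, Finset.coe_univ, Set.image_univ,
    ← Set.range_comp]
  ext p
  simp only [Set.mem_image, permMatrixPoints, Set.mem_setOf_eq, Set.mem_range, Function.comp]
  constructor
  · rintro ⟨x, ⟨ρ, rfl⟩, rfl⟩
    exact ⟨ρ, (intProj_permMatrix a b ρ).symm⟩
  · rintro ⟨ρ, rfl⟩
    exact ⟨_, ⟨ρ, rfl⟩, intProj_permMatrix a b ρ⟩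

/-- For a separating pattern, the shadow vertex count along `intProj a b` is the Newton vertex
count of `DET_n(X^a Y^b)`. -/
theorem birkhoffShadowVertexCount_intProj {n : ℕ} (a b : Fin n × Fin n → ℕ)
    (hinj : Function.Injective (permExp a b)) :
    birkhoffShadowVertexCount (intProj a b) =
      newtonVertexCount (MvPolynomial.aeval (monoSubst a b) (detPoly (Fin n) ℂ)) := by
  simp only [birkhoffShadowVertexCount, newtonVertexCount]
  rw [image_intProj_permMatrixPoints a b hinj]

/-- A separating pair `(a, b)` makes `ρ ↦ permExp a b ρ` injective. [folklore] -/
theorem permExp_injective_of_pair {n : ℕ} (a b : Fin n × Fin n → ℕ)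
    (hpair : Function.Injective fun ρ : Equiv.Perm (Fin n) => (∑ j, a (ρ j, j), ∑ j, b (ρ j, j))) :
    Function.Injective (permExp a b) := by
  intro ρ ρ' h
  apply hpair
  have h0 := congrArg (fun e : Fin 2 →₀ ℕ => e 0) h
  have h1 := congrArg (fun e : Fin 2 →₀ ℕ => e 1) h
  simp only [permExp_apply_zero, permExp_apply_one] at h0 h1
  exact Prod.ext h0 h1

/-- The **separating-shadow ceiling** predicted by the Newton-polygon τ-conjecture: one constant
`c` such that for every `n` and every pair of exponent matrices `a b : Fin n × Fin n → ℕ` whose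
projection `ρ ↦ (∑_j a(ρ j, j), ∑_j b(ρ j, j))` separates the `n!` permutations, the shadow of the
Birkhoff polytope `DS_n` along `x ↦ (⟨a,x⟩, ⟨b,x⟩)` has at most `(n+2)^{c(⌊√n⌋+1)} = 2^{O(√n log n)}`
vertices.  OPEN (Hrubeš–Yehudayoff 2021, Open Problem 1, ask on the contrary whether
`σ(DS_n) = 2^{Ω(n)}`; known: `2^{Ω(log² n)} ≤ σ(DS_n) ≤ 2^{O(n)}`, Prop. 23).  Its NEGATION — a lower
bound `2^{ω(√n log n)}` along separating integral projections — refutes `KPTT.newtonTauWeak`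
(contrapositive of `separatingShadowCeiling_of_newtonTauWeak`).  A `Prop`; nothing is asserted. -/
@[conjecture] def SeparatingShadowCeiling : Prop :=
  ∃ c : ℕ, ∀ (n : ℕ) (a b : Fin n × Fin n → ℕ),
    Function.Injective (fun ρ : Equiv.Perm (Fin n) => (∑ j, a (ρ j, j), ∑ j, b (ρ j, j))) →
      birkhoffShadowVertexCount (intProj a b) ≤ (n + 2) ^ (c * (Nat.sqrt n + 1))

/-- **Kill switch of the Newton-polygon line (Hrubeš–Yehudayoff 2021, footnote 1, weak form):
`newtonTauWeak` implies the separating-shadow ceiling `σ_sep(DS_n) ≤ 2^{O(√n log n)}`.** -/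
theorem separatingShadowCeiling_of_newtonTauWeak (hW : KPTT.newtonTauWeak) :
    SeparatingShadowCeiling := by
  obtain ⟨c, hc⟩ := newtonVertexCount_aeval_detPoly_le_of_newtonTauWeak hW
  refine ⟨c, fun n a b hpair => ?_⟩
  rw [birkhoffShadowVertexCount_intProj a b (permExp_injective_of_pair a b hpair)]
  exact hc n (monoSubst a b) (isMvTerm_monoSubst a b)

end Summit.ValiantsHypothesis.ValiantsHypothesis.Theorems
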